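import Literature.NumberTheory.EllipticCurves.Rank1Residual.Typed.X5DescentItemConverse
import HarnessLib

/-!
# X5 (p = 2): on a `#Ш[2] = 4` row, `BSD(E, 2)` ⟺ ONE Selmer item — the kernel equivalence

Support file for the BSD rank-≤ 1 residual programme, class X5 (`p = 2`), unit `b2b-bsdres-sha-1`
(gen 6). Honest framing: prove what is provable now; shrink each hard class to its core with data;
no claim beyond stated classes. Everything here is proved; the named facts entering are
Gross–Zagier–Kolyvagin (`hGZK`) and the Cassels–Tate pairing bsd.S18 (`hCT`), as hypotheses.
Nothing is claimed for any curve.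

`X5DescentAnyLevel` (item ⟹ datum ⟹ `BSD(E, 2)`) and `X5DescentItemConverse` (datum ⟹ item) are
joined with the tree's `X5.descentCertificateAt_of_bsdp_two` (`BSD(E, 2)` ⟹ SOME datum) to give,
for a curve of analytic rank `≤ 1` with `#E(ℚ)[2] = 2^t`, `#Sel^(2)(E/ℚ) = 2^(r_an+t+2)`
(`#Ш[2] = 4`), every `2^k`-Selmer class lifting one level (`Ш[2^k] ⊆ 2Ш`) and `ord₂ #Ш_an = 2(k+1)`:

  `BSD(E, 2)` **iff** SOME `s ∈ Sel^(2^(k+1))(E/ℚ)` lies outside `[2]_* Sel^(2^(k+2))(E/ℚ)`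

(`X5.bsdp_two_iff_exists_selmer_item_level`). The step `BSD(E, 2) ⟹ Ш[2^(k+2)] = Ш[2^(k+1)]`
(`stable_of_certificate_level`, `X5.stable_level_of_bsdp_two`) compares the datum's level with
`k + 1` through the counts (`#Ш[2^(k+1)] = 4^(k+1)` by the lifting line; a datum at a higher level
has the same cardinality, so the torsion subgroups coincide; at a lower level stabilisation
propagates upward). On the two lower-bound-only rows of the census (19074h1/h2, `k = 2`) the typed
OPEN item is therefore EXACTLY `BSD(E, 2)` granted GZK and bsd.S18 — no claim is made about it.

References: Silverman, *AEC* (2009), Thm. X.4.2, Thm. X.4.14; Cassels (1962), Arithmetic IV,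
Thm. 1.1; Cassels (1998), §1; Stamminger (2005), Thm. 6.2.2; Miller (2011), Def. 1.1.
-/

noncomputable section

open scoped Classical
open scoped AddSubgroup

open WeierstrassCurve Literature.NumberTheory.EllipticCurves
  Literature.NumberTheory.EllipticCurves.Rank1Residual
  Literature.GroupTheory.FiniteAbelian

namespace Literature.NumberTheory.EllipticCurves.Rank1Residual.Typed

/-! ### §1 Algebra: a datum at ANY level pins the stabilisation at the counted level -/

section Algebra

variable {A : Type*} [AddCommGroup A]

/-- `2^(j+1) • v = 2^j • (2 • v)` (content-free private helper). [folklore] -/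
private theorem two_pow_succ_smul₁₀ (j : ℕ) (v : A) : 2 ^ (j + 1) • v = 2 ^ j • (2 • v) := by
  rw [smul_smul, pow_succ]

/-- `2^(a+j) • x = 2^j • (2^a • x)` (content-free private helper). [folklore] -/
private theorem two_pow_add_smul₁₀ (a j : ℕ) (x : A) : 2 ^ (a + j) • x = 2 ^ j • (2 ^ a • x) := by
  rw [smul_smul, ← pow_add, add_comm]

/-- **Stabilisation propagates upward**: `A[2^(k'+1)] = A[2^k']` ⟹ `A[2^(k'+j)] = A[2^k']` for every
`j`. [cite: SilvermanAEC2009, Thm. X.4.14] [cite: Miller2011LMS, Def. 1.1] -/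
theorem two_pow_smul_eq_zero_of_stable {k' : ℕ}
    (hstab : ∀ x : A, 2 ^ (k' + 1) • x = 0 → 2 ^ k' • x = 0) :
    ∀ (j : ℕ) (x : A), 2 ^ (k' + j) • x = 0 → 2 ^ k' • x = 0 := by
  intro j
  induction j with
  | zero => intro x hx; simpa using hx
  | succ j ih =>
    intro x hx
    rw [← add_assoc, two_pow_succ_smul₁₀] at hx
    have h := ih (2 • x) hx
    apply hstab
    rw [two_pow_succ_smul₁₀]
    exact h

/-- **A datum at ANY level `k'` with `#A[2^k'] = 2^m = #A[2^(k+1)]` gives the stabilisation at level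
`k + 1`**: if `k' ≤ k + 1`, stabilisation propagates upward; if `k' ≥ k + 2`, then
`A[2^(k+1)] ≤ A[2^(k+2)] ≤ A[2^k']` with the outer two of the same finite cardinality, so all three
coincide. [cite: SilvermanAEC2009, Thm. X.4.2(a), Thm. X.4.14] [cite: Miller2011LMS, Def. 1.1] -/
theorem stable_of_certificate_level {k k' m : ℕ}
    (hstab' : ∀ x : A, 2 ^ (k' + 1) • x = 0 → 2 ^ k' • x = 0)
    (hcard' : Nat.card (A[(2 ^ k' : ℕ)]) = 2 ^ m) (hcard : Nat.card (A[(2 ^ (k + 1) : ℕ)]) = 2 ^ m) :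
    ∀ z : A, 2 ^ (k + 2) • z = 0 → 2 ^ (k + 1) • z = 0 := by
  intro z hz
  rcases le_or_gt k' (k + 1) with hle | hlt
  · obtain ⟨j, hj⟩ := Nat.exists_eq_add_of_le hle
    have hz' : 2 ^ (k' + (j + 1)) • z = 0 := by
      have e : k' + (j + 1) = k + 2 := by omega
      rw [e]; exact hz
    have h0 := two_pow_smul_eq_zero_of_stable hstab' (j + 1) z hz'
    rw [hj, two_pow_add_smul₁₀, h0, smul_zero]
  · have hmemk : ∀ x : A, x ∈ A[(2 ^ k' : ℕ)] ↔ 2 ^ k' • x = 0 := fun x =>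
      AddSubgroup.torsionBy.nsmul_iff (n := 2 ^ k')
    have hmemS : ∀ x : A, x ∈ A[(2 ^ (k + 1) : ℕ)] ↔ 2 ^ (k + 1) • x = 0 := fun x =>
      AddSubgroup.torsionBy.nsmul_iff (n := 2 ^ (k + 1))
    have hle : A[(2 ^ (k + 1) : ℕ)] ≤ A[(2 ^ k' : ℕ)] := by
      intro x hx
      rw [hmemS] at hx
      rw [hmemk]
      have e : k' = (k + 1) + (k' - (k + 1)) := by omega
      rw [e, two_pow_add_smul₁₀, hx, smul_zero]
    haveI : Finite (A[(2 ^ k' : ℕ)]) := Nat.finite_of_card_ne_zero (by rw [hcard']; positivity)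
    have heq : A[(2 ^ (k + 1) : ℕ)] = A[(2 ^ k' : ℕ)] :=
      AddSubgroup.eq_of_le_of_card_ge hle (by rw [hcard, hcard'])
    have hzmem : z ∈ A[(2 ^ k' : ℕ)] := by
      rw [hmemk]
      have e : k' = (k + 2) + (k' - (k + 2)) := by omega
      rw [e, two_pow_add_smul₁₀, hz, smul_zero]
    rw [← heq, hmemS] at hzmem
    exact hzmem

end Algebra

/-! ### §2 `Ш(E/ℚ)` and the Selmer groups: the equivalence -/

section Sha

variable (W : WeierstrassCurve ℚ) [W.IsElliptic] [W.IsGloballyMinimal]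

omit [W.IsElliptic] [W.IsGloballyMinimal] in
/-- **`BSD(E, 2)` ⟹ the stabilisation at the counted level.** On a finite `Ш` with `#Ш[2] = 4`,
`Ш[2^k] ⊆ 2Ш` (so `#Ш[2^(k+1)] = 4^(k+1)`) and `ord₂ #Ш_an = 2(k+1)`: `BSD(E, 2)` (through the
tree's `X5.descentCertificateAt_of_bsdp_two`: a datum at SOME level) forces
`Ш[2^(k+2)] = Ш[2^(k+1)]`. [cite: Miller2011LMS, Def. 1.1] [cite: SilvermanAEC2009, Thm. X.4.2(a)] -/
theorem X5.stable_level_of_bsdp_two {k : ℕ} [Finite W.sha] (hbsd : BSDp W 2)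
    (h2 : Nat.card (AddSubgroup.torsionBy W.sha 2) = 4)
    (hdiv : ∀ y : W.sha, 2 ^ k • y = 0 → ∃ x : W.sha, 2 • x = y)
    {q : ℚ} (hq : shaAn W = (q : ℂ)) (hv : padicValRat 2 q = ((2 * (k + 1) : ℕ) : ℤ)) :
    ∀ z : W.sha, 2 ^ (k + 2) • z = 0 → 2 ^ (k + 1) • z = 0 := by
  obtain ⟨k', m, hstab', hcard', q', hq', hv'⟩ := X5.descentCertificateAt_of_bsdp_two W hbsd
  have hqq : q' = q := by
    have e : ((q' : ℂ)) = (q : ℂ) := by rw [← hq', hq]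
    exact_mod_cast e
  subst hqq
  have hm : m = 2 * (k + 1) := by
    have e : (m : ℤ) = ((2 * (k + 1) : ℕ) : ℤ) := by rw [← hv', hv]
    exact_mod_cast e
  subst hm
  have hcount : Nat.card ((W.sha)[(2 ^ (k + 1) : ℕ)]) = 2 ^ (2 * (k + 1)) := by
    rw [card_torsionBy_two_pow_of_two_divisible (by simpa using h2) hdiv, pow_mul]; norm_num
  exact stable_of_certificate_level hstab' hcard' hcount

/-- **THE KERNEL EQUIVALENCE on a `#Ш[2] = 4` row.** Granted GZK (`hGZK`) and bsd.S18 (`hCT`): for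
a curve of analytic rank `≤ 1` with `#E(ℚ)[2] = 2^t`, `#Sel^(2)(E/ℚ) = 2^(r_an+t+2)`, every
`2^k`-Selmer class lifting to `Sel^(2^(k+1))(E/ℚ)`, and `ord₂ #Ш_an = 2(k+1)`:
`BSD(E, 2)` **iff** SOME `s ∈ Sel^(2^(k+1))(E/ℚ)` lies outside `[2]_* Sel^(2^(k+2))(E/ℚ)`.
On the lower-bound-only census rows (19074h1/h2, `k = 2`, all listed hypotheses certified) the
typed OPEN item is thus exactly `BSD(E, 2)`; nothing is claimed about it.
[cite: SilvermanAEC2009, Thm. X.4.2(a), Thm. X.4.14; Cassels1962ArithmeticIV, Thm. 1.1; Cassels1998, §1; Stamminger2005, Thm. 6.2.2; Miller2011LMS, Def. 1.1] -/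
theorem X5.bsdp_two_iff_exists_selmer_item_level {k : ℕ}
    (hGZK : rank_eq_analyticRank_of_analyticRank_le_one)
    (hCT : WeierstrassCurve.exists_casselsTate_pairing (K := ℚ)) (hr : W.analyticRank ≤ 1) {t : ℕ}
    (ht : Nat.card (AddSubgroup.torsionBy W.toAffine.Point 2) = 2 ^ t)
    (hSel : Nat.card (W.selmerGroup 2) = 2 ^ (W.analyticRank + t + 2))
    (hF : ∀ s : W.selmerGroup (2 ^ k : ℕ), ∃ z : W.selmerGroup (2 ^ (k + 1) : ℕ),
      W.selmerZSMul 2 (two_pow_succ_dvd_mul_two k) z = s)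
    {q : ℚ} (hq : shaAn W = (q : ℂ)) (hv : padicValRat 2 q = ((2 * (k + 1) : ℕ) : ℤ)) :
    BSDp W 2 ↔ ∃ s : W.selmerGroup (2 ^ (k + 1) : ℕ), ¬ ∃ z : W.selmerGroup (2 ^ (k + 2) : ℕ),
      W.selmerZSMul 2 (two_pow_succ_dvd_mul_two (k + 1)) z = s := by
  haveI : Finite W.sha := (hGZK W hr).2
  have h2 := X5.card_sha_two_of_card_selmerTwo W (hGZK W hr).1 ht hSel
  refine ⟨fun hbsd => X5.exists_not_mem_selmer_of_stable_level W h2 hF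
      (X5.stable_level_of_bsdp_two W hbsd h2 (X5.two_divisible_of_selmer_lift_level W hF) hq hv),
    fun hs => ?_⟩
  obtain ⟨s, hs⟩ := hs
  exact X5.bsdp_two_of_selmer_item_level W hGZK hCT hr ht hSel hF hs hq hv

end Sha

end Literature.NumberTheory.EllipticCurves.Rank1Residual.Typed

end
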